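import Mathlib
import HarnessLib
import Summits.KontsevichZagierPeriods.Zeta5Search.BarnesMellin
import Literature.Analysis.SpecialFunctions.GammaStirlingVertical
import Literature.Analysis.Complex.MellinBarnesShift

/-!
# ζ(5) search — the Mellin–Barnes integral for `(1+w)^{-a}`, COMPLEX exponent (cell `pub-zeta5`, seat ct-1 g26)

HONEST FRAMING: systematic search; no irrationality claim unless kernel-certified.  An identity of special functions;
nothing here is an irrationality result, a worthiness exponent or a denominator statement.

This file generalises ct-1 g11's `BarnesMellin.mellin_barnes` (integer exponent `m+1`, decay of `Γ(s)Γ(m+1−s)` via the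
reflection formula) to an arbitrary complex exponent `a` with `Re a > 0`:

* `mellin_oneAdd_cpow_neg` — `mellin (t ↦ (1+t)^{−a}) s = Γ(s)Γ(a−s)/Γ(a)` on `0 < Re s < Re a` (the Beta integral on `(0,∞)`,
  by the substitution `t = x/(1−x)` and `BarnesCube`/Mathlib's Beta integral on `(0,1)`);
* `integrable_Gamma_vertical_cpow` — `y ↦ Γ(σ+iy)Γ(a−σ−iy)` is integrable on `ℝ` for `0 < σ < Re a`; the decay now comes
  from Stirling's formula on vertical lines, `Literature.Analysis.SpecialFunctions.GammaStirlingVertical.exists_norm_Gamma_vertical_le`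
  (`‖Γ(x+iu)‖ ≤ C|u|^{x−1/2}e^{−π|u|/2}`), combined through `Literature.Analysis.Complex.MellinBarnesShift.exists_rpow_mul_exp_neg_le`;
* `mellin_barnes_cpow` — for real `w > 0` and `0 < σ < Re a`,
  `(1+w)^{−a} = (1/2π) ∫_ℝ w^{s} Γ(a+s)Γ(−s)/Γ(a) dy`, `s = −σ+iy` (Mathlib's Mellin inversion `mellinInv_mellin_eq`).

It is brick B1 of the blueprint `HOME/ct-1/g26/VWP-BLUEPRINT.md` for the Literature fact
`Zudilin2002.vwp_eq_integral_of_pos` (Nesterenko's Lemma 2 = this identity inside an Euler integral).  Theorems only.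
-/

noncomputable section

namespace Summit.KontsevichZagierPeriods.Zeta5Search.BarnesMellinCpow

open MeasureTheory Set Filter Asymptotics
open scoped Topology Real
open Summit.KontsevichZagierPeriods.Zeta5Search.BarnesMellin

/-! ### 1. The function `t ↦ (1+t)^{-a}` on `(−1, ∞)` -/

/-- `1 + ↑t` is the cast of the real number `1 + t`. -/
theorem one_add_ofReal (t : ℝ) : (1 : ℂ) + (t : ℂ) = ((1 + t : ℝ) : ℂ) := by push_cast; ring

/-- Continuity of `t ↦ (1+t)^{-a}` at every `t > -1` (the base stays in the slit plane). -/
theorem continuousAt_oneAdd_cpow (a : ℂ) {t : ℝ} (ht : -1 < t) :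
    ContinuousAt (fun t : ℝ => (1 + (t : ℂ)) ^ (-a)) t := by
  have h1 : ContinuousAt (fun t : ℝ => (1 : ℂ) + (t : ℂ)) t :=
    (by fun_prop : Continuous fun t : ℝ => (1 : ℂ) + (t : ℂ)).continuousAt
  have hslit : (1 : ℂ) + (t : ℂ) ∈ Complex.slitPlane := by
    rw [one_add_ofReal]; exact Complex.ofReal_mem_slitPlane.2 (by linarith)
  exact ContinuousAt.comp (f := fun t : ℝ => (1 : ℂ) + (t : ℂ)) (g := fun z : ℂ => z ^ (-a))
    (continuousAt_cpow_const hslit) h1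

/-- Norm of `(1+t)^{-a}` for `t > -1`: `(1+t)^{-Re a}`. -/
theorem norm_oneAdd_cpow (a : ℂ) {t : ℝ} (ht : -1 < t) : ‖(1 + (t : ℂ)) ^ (-a)‖ = (1 + t) ^ (-a.re) := by
  rw [one_add_ofReal, Complex.norm_cpow_eq_rpow_re_of_pos (by linarith), Complex.neg_re]

/-- The Mellin transform of `t ↦ (1+t)^{-a}` converges on `0 < Re s < Re a`. -/
theorem mellinConvergent_oneAdd_cpow (a : ℂ) {s : ℂ} (hs : 0 < s.re) (hs' : s.re < a.re) :
    MellinConvergent (fun t : ℝ => (1 + (t : ℂ)) ^ (-a)) s := by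
  have hcont : ContinuousOn (fun t : ℝ => (1 + (t : ℂ)) ^ (-a)) (Ioi 0) :=
    continuousOn_of_forall_continuousAt fun t ht => continuousAt_oneAdd_cpow a (by linarith [mem_Ioi.mp ht])
  refine mellinConvergent_of_isBigO_rpow (a := a.re) (b := 0)
    (hcont.locallyIntegrableOn measurableSet_Ioi) ?_ (by simpa using hs') ?_ (by simpa using hs)
  · refine IsBigO.of_bound 1 ?_
    filter_upwards [eventually_ge_atTop (1 : ℝ)] with x hx
    have hx0 : 0 < x := by linarith
    rw [norm_oneAdd_cpow a (by linarith), one_mul, Real.norm_of_nonneg (Real.rpow_nonneg hx0.le _)]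
    exact Real.rpow_le_rpow_of_nonpos hx0 (by linarith) (by linarith)
  · refine IsBigO.of_bound 1 ?_
    filter_upwards [self_mem_nhdsWithin] with x hx
    have hx0 : 0 < x := hx
    rw [norm_oneAdd_cpow a (by linarith), neg_zero, Real.rpow_zero, norm_one, mul_one]
    exact Real.rpow_le_one_of_one_le_of_nonpos (by linarith) (by linarith)

/-! ### 2. The Mellin transform is the Beta integral `Γ(s)Γ(a−s)/Γ(a)` -/

/-- The substituted Beta integrand: for `x ∈ (0,1)`,
`|1/(1−x)²| · (x/(1−x))^{s−1} · (1 + x/(1−x))^{-a} = x^{s−1}(1−x)^{(a−s)−1}`. -/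
theorem subst_integrand_cpow {x : ℝ} (hx : x ∈ Ioo (0 : ℝ) 1) (s a : ℂ) :
    |1 / (1 - x) ^ 2| • (((x / (1 - x) : ℝ) : ℂ) ^ (s - 1) * (1 + ((x / (1 - x) : ℝ) : ℂ)) ^ (-a)) =
      (x : ℂ) ^ (s - 1) * (1 - (x : ℂ)) ^ (a - s - 1) := by
  have hx0 : 0 < x := hx.1
  have hx1 : 0 < 1 - x := by linarith [hx.2]
  have hb : ((1 - x : ℝ) : ℂ) ≠ 0 := by exact_mod_cast hx1.ne'
  rw [cpow_ofReal_div hx0.le hx1 (s - 1)]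
  have h1 : (1 : ℂ) + ((x / (1 - x) : ℝ) : ℂ) = (((1 - x : ℝ) : ℂ))⁻¹ := by
    rw [Complex.ofReal_div]
    field_simp
    push_cast; ring
  have harg : (((1 - x : ℝ) : ℂ)).arg ≠ π := by
    rw [Complex.arg_ofReal_of_nonneg hx1.le]; exact Real.pi_ne_zero.symm
  have h2 : ((((1 - x : ℝ) : ℂ))⁻¹) ^ (-a) = ((1 - x : ℝ) : ℂ) ^ a := by
    rw [Complex.inv_cpow _ _ harg, Complex.cpow_neg, inv_inv]
  rw [h1, h2, abs_of_pos (by positivity), Complex.real_smul]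
  have e1 : (((1 / (1 - x) ^ 2 : ℝ)) : ℂ) = ((1 - x : ℝ) : ℂ) ^ (-(2 : ℂ)) := by
    rw [Complex.cpow_neg, show (2 : ℂ) = ((2 : ℕ) : ℂ) by norm_num, Complex.cpow_natCast]
    push_cast; ring
  rw [e1]
  have e3 : ((1 - x : ℝ) : ℂ) ^ (-(2 : ℂ)) * ((x : ℂ) ^ (s - 1) * ((1 - x : ℝ) : ℂ) ^ (-(s - 1)) *
      ((1 - x : ℝ) : ℂ) ^ a) =
      (x : ℂ) ^ (s - 1) * (((1 - x : ℝ) : ℂ) ^ (-(2 : ℂ)) * ((1 - x : ℝ) : ℂ) ^ (-(s - 1)) *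
        ((1 - x : ℝ) : ℂ) ^ a) := by ring
  rw [e3, ← Complex.cpow_add _ _ hb, ← Complex.cpow_add _ _ hb,
    show (-(2 : ℂ) + -(s - 1) + a) = a - s - 1 by ring]
  push_cast
  rfl

/-- **The Mellin transform of `(1+t)^{-a}`** is `Γ(s)Γ(a−s)/Γ(a)` on the strip `0 < Re s < Re a` (Euler's Beta
integral on `(0,∞)`; `(1+t)^{-a}` is Mathlib's principal-branch `cpow` of the positive real base `1+t`, `t > 0`,
i.e. `exp(−a·log(1+t))` with the real logarithm; the Mellin transform `mellin f s = ∫_{(0,∞)} t^{s−1} f(t) dt` is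
Mathlib's). -/
theorem mellin_oneAdd_cpow_neg (a : ℂ) {s : ℂ} (hs : 0 < s.re) (hs' : s.re < a.re) :
    mellin (fun t : ℝ => (1 + (t : ℂ)) ^ (-a)) s =
      Complex.Gamma s * Complex.Gamma (a - s) / Complex.Gamma a := by
  have hcv := integral_image_eq_integral_abs_deriv_smul measurableSet_Ioo
    (fun x hx => hasDerivWithinAt_div_one_sub hx) injOn_div_one_sub
    (fun t : ℝ => (t : ℂ) ^ (s - 1) • (1 + (t : ℂ)) ^ (-a))
  rw [image_div_one_sub] at hcv
  rw [mellin, hcv]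
  have hpt : ∀ x ∈ Ioo (0 : ℝ) 1,
      |1 / (1 - x) ^ 2| • (((x / (1 - x) : ℝ) : ℂ) ^ (s - 1) • (1 + ((x / (1 - x) : ℝ) : ℂ)) ^ (-a)) =
        (x : ℂ) ^ (s - 1) * (1 - (x : ℂ)) ^ (a - s - 1) := by
    intro x hx
    rw [smul_eq_mul]
    exact subst_integrand_cpow hx s a
  rw [setIntegral_congr_fun measurableSet_Ioo hpt]
  have hB : ∫ x in Ioo (0 : ℝ) 1, (x : ℂ) ^ (s - 1) * (1 - (x : ℂ)) ^ (a - s - 1) =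
      Complex.betaIntegral s (a - s) := by
    rw [Complex.betaIntegral, intervalIntegral.integral_of_le zero_le_one, integral_Ioc_eq_integral_Ioo]
  rw [hB]
  have hre : 0 < (a - s).re := by simp; linarith
  have ha : 0 < a.re := hs.trans hs'
  have key := Complex.Gamma_mul_Gamma_eq_betaIntegral hs hre
  rw [show s + (a - s) = a by ring] at key
  rw [eq_div_iff (Complex.Gamma_ne_zero_of_re_pos ha), mul_comm, key]

/-! ### 3. Vertical integrability of `Γ(σ+iy)Γ(a−σ−iy)` from Stirling's formula -/

/-- `y^q ≤ (K+y)^{max q 0}` for `y ≥ 1`, `K ≥ 0`. -/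
theorem rpow_le_add_rpow_max {y K q : ℝ} (hy : 1 ≤ y) (hK : 0 ≤ K) : y ^ q ≤ (K + y) ^ (max q 0) := by
  rcases le_or_gt q 0 with hq | hq
  · rw [max_eq_right hq, Real.rpow_zero]
    exact Real.rpow_le_one_of_one_le_of_nonpos hy hq
  · rw [max_eq_left hq.le]
    exact Real.rpow_le_rpow (by linarith) (by linarith) hq.le

/-- **Exponential tail bound**: for every real `σ` and complex `a` there is `R` with `‖Γ(σ+iy)Γ(a−(σ+iy))‖ ≤ e^{−|y|}`
for `|y| ≥ R` (Stirling on the two vertical lines: the product decays like a power of `|y|` times `e^{−π|y|}`; far out on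
the lines there are no poles, so no hypothesis on `σ` is needed). -/
theorem norm_Gamma_mul_Gamma_cpow_le (a : ℂ) (σ : ℝ) :
    ∃ R : ℝ, ∀ y : ℝ, R ≤ |y| →
      ‖Complex.Gamma ((σ : ℂ) + (y : ℂ) * Complex.I) * Complex.Gamma (a - ((σ : ℂ) + (y : ℂ) * Complex.I))‖ ≤
        1 * Real.exp (-1 * |y|) := by
  obtain ⟨C₁, hC₁, h₁⟩ := Literature.Analysis.SpecialFunctions.GammaStirling.exists_norm_Gamma_vertical_le σ σ
  obtain ⟨C₂, hC₂, h₂⟩ := Literature.Analysis.SpecialFunctions.GammaStirling.exists_norm_Gamma_vertical_le (a.re - σ) (a.re - σ)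
  set K : ℝ := 1 + |a.im| with hK
  set p : ℝ := max (σ - 1 / 2) 0 + max (a.re - σ - 1 / 2) 0 with hp
  have hK0 : 0 ≤ K := by positivity
  have hp0 : 0 ≤ p := add_nonneg (le_max_right _ _) (le_max_right _ _)
  have hpi : 0 < π - 1 := by linarith [Real.pi_gt_three]
  set M : ℝ := C₁ * C₂ * Real.exp (π * |a.im| / 2) with hM
  have hM0 : 0 < M := by positivity
  obtain ⟨T₀, hT₀⟩ := Literature.Analysis.Complex.exists_rpow_mul_exp_neg_le hK0 hp0 hpi (ε := M⁻¹) (inv_pos.2 hM0)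
  refine ⟨max T₀ (|a.im| + 2), fun y hy => ?_⟩
  have hyT : T₀ ≤ |y| := le_of_max_le_left hy
  have hy2 : |a.im| + 2 ≤ |y| := le_of_max_le_right hy
  have hy1 : 1 ≤ |y| := by linarith [abs_nonneg a.im]
  have hu_ge : |y| - |a.im| ≤ |a.im - y| := by
    have := abs_sub_abs_le_abs_sub y a.im
    rw [abs_sub_comm] at this
    linarith [le_abs_self (|y| - |a.im|)]
  have hu1 : 1 ≤ |a.im - y| := by linarith
  have hu_le : |a.im - y| ≤ K + |y| := by
    calc |a.im - y| ≤ |a.im| + |y| := abs_sub _ _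
      _ ≤ K + |y| := by rw [hK]; linarith
  -- the two Stirling bounds
  have g1 := h₁ σ (by simp) y hy1
  have g2 := h₂ (a.re - σ) (by simp) (a.im - y) hu1
  have ha_split : a - ((σ : ℂ) + (y : ℂ) * Complex.I) = ((a.re - σ : ℝ) : ℂ) + ((a.im - y : ℝ) : ℂ) * Complex.I := by
    apply Complex.ext <;> simp
  rw [norm_mul, ha_split]
  -- polynomial factors
  have q1 : |y| ^ (σ - 1 / 2) ≤ (K + |y|) ^ (max (σ - 1 / 2) 0) := rpow_le_add_rpow_max hy1 hK0
  have q2 : |a.im - y| ^ (a.re - σ - 1 / 2) ≤ (K + |y|) ^ (max (a.re - σ - 1 / 2) 0) := by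
    rcases le_or_gt (a.re - σ - 1 / 2) 0 with hq | hq
    · rw [max_eq_right hq, Real.rpow_zero]
      exact Real.rpow_le_one_of_one_le_of_nonpos hu1 hq
    · rw [max_eq_left hq.le]
      exact Real.rpow_le_rpow (abs_nonneg _) hu_le hq.le
  -- exponential factors
  have x2 : Real.exp (-(π * |a.im - y|) / 2) ≤ Real.exp (π * |a.im| / 2) * Real.exp (-(π * |y|) / 2) := by
    rw [← Real.exp_add]
    apply Real.exp_le_exp.2
    nlinarith [Real.pi_pos, hu_ge]
  have hKy : 0 < K + |y| := by linarith
  have prod_rpow : (K + |y|) ^ (max (σ - 1 / 2) 0) * (K + |y|) ^ (max (a.re - σ - 1 / 2) 0) = (K + |y|) ^ p := by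
    rw [hp, Real.rpow_add hKy]
  have hexp : Real.exp (-(π * |y|) / 2) * Real.exp (-(π * |y|) / 2) =
      Real.exp (-((π - 1) * |y|)) * Real.exp (-1 * |y|) := by
    rw [← Real.exp_add, ← Real.exp_add]; ring_nf
  have hTail := hT₀ y hyT
  calc ‖Complex.Gamma ((σ : ℂ) + (y : ℂ) * Complex.I)‖ *
        ‖Complex.Gamma (((a.re - σ : ℝ) : ℂ) + ((a.im - y : ℝ) : ℂ) * Complex.I)‖
      ≤ (C₁ * |y| ^ (σ - 1 / 2) * Real.exp (-(π * |y|) / 2)) *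
          (C₂ * |a.im - y| ^ (a.re - σ - 1 / 2) * Real.exp (-(π * |a.im - y|) / 2)) :=
        mul_le_mul g1 g2 (norm_nonneg _) (by positivity)
    _ ≤ (C₁ * (K + |y|) ^ (max (σ - 1 / 2) 0) * Real.exp (-(π * |y|) / 2)) *
          (C₂ * (K + |y|) ^ (max (a.re - σ - 1 / 2) 0) * (Real.exp (π * |a.im| / 2) * Real.exp (-(π * |y|) / 2))) := by
        gcongr
    _ = M * ((K + |y|) ^ p * Real.exp (-((π - 1) * |y|))) * Real.exp (-1 * |y|) := by
        rw [hM, ← prod_rpow]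
        have := hexp
        calc C₁ * (K + |y|) ^ max (σ - 1 / 2) 0 * Real.exp (-(π * |y|) / 2) *
              (C₂ * (K + |y|) ^ max (a.re - σ - 1 / 2) 0 * (Real.exp (π * |a.im| / 2) * Real.exp (-(π * |y|) / 2)))
            = C₁ * C₂ * Real.exp (π * |a.im| / 2) * ((K + |y|) ^ max (σ - 1 / 2) 0 *
                (K + |y|) ^ max (a.re - σ - 1 / 2) 0) * (Real.exp (-(π * |y|) / 2) * Real.exp (-(π * |y|) / 2)) := by
              ring
          _ = _ := by rw [this]; ring
    _ ≤ 1 * Real.exp (-1 * |y|) := by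
        have hX : M * ((K + |y|) ^ p * Real.exp (-((π - 1) * |y|))) ≤ 1 := by
          calc M * ((K + |y|) ^ p * Real.exp (-((π - 1) * |y|))) ≤ M * M⁻¹ :=
                mul_le_mul_of_nonneg_left hTail hM0.le
            _ = 1 := mul_inv_cancel₀ hM0.ne'
        exact mul_le_mul_of_nonneg_right hX (Real.exp_pos _).le

/-- Continuity of `y ↦ Γ(σ+iy)Γ(a−(σ+iy))` for `0 < σ < Re a` (no poles on either line). -/
theorem continuous_Gamma_vertical_cpow (a : ℂ) {σ : ℝ} (hσ : 0 < σ) (hσ' : σ < a.re) :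
    Continuous fun y : ℝ =>
      Complex.Gamma ((σ : ℂ) + (y : ℂ) * Complex.I) * Complex.Gamma (a - ((σ : ℂ) + (y : ℂ) * Complex.I)) := by
  have hc1 : Continuous fun y : ℝ => (σ : ℂ) + (y : ℂ) * Complex.I := by fun_prop
  have hc2 : Continuous fun y : ℝ => a - ((σ : ℂ) + (y : ℂ) * Complex.I) := by fun_prop
  refine Continuous.mul ?_ ?_
  · refine continuous_iff_continuousAt.mpr fun y => (Complex.continuousAt_Gamma _ ?_).comp hc1.continuousAt
    exact ne_neg_nat_of_re_pos (by simp [hσ])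
  · refine continuous_iff_continuousAt.mpr fun y => (Complex.continuousAt_Gamma _ ?_).comp hc2.continuousAt
    exact ne_neg_nat_of_re_pos (by simp; linarith)

/-- **Vertical integrability** of `y ↦ Γ(σ+iy)Γ(a−(σ+iy))` for `0 < σ < Re a`. -/
theorem integrable_Gamma_vertical_cpow (a : ℂ) {σ : ℝ} (hσ : 0 < σ) (hσ' : σ < a.re) :
    Integrable fun y : ℝ =>
      Complex.Gamma ((σ : ℂ) + (y : ℂ) * Complex.I) * Complex.Gamma (a - ((σ : ℂ) + (y : ℂ) * Complex.I)) := by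
  obtain ⟨R, hR⟩ := norm_Gamma_mul_Gamma_cpow_le a σ
  exact integrable_of_norm_le_exp (continuous_Gamma_vertical_cpow a hσ hσ') one_pos (R := R) hR

/-- Vertical integrability of the Mellin transform of `(1+t)^{-a}` on `Re s = σ ∈ (0, Re a)`. -/
theorem verticalIntegrable_mellin_oneAdd_cpow (a : ℂ) {σ : ℝ} (hσ : 0 < σ) (hσ' : σ < a.re) :
    Complex.VerticalIntegrable (mellin fun t : ℝ => (1 + (t : ℂ)) ^ (-a)) σ := by
  unfold Complex.VerticalIntegrable
  have heq : (fun y : ℝ => mellin (fun t : ℝ => (1 + (t : ℂ)) ^ (-a)) ((σ : ℂ) + (y : ℂ) * Complex.I)) =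
      fun y : ℝ => Complex.Gamma ((σ : ℂ) + (y : ℂ) * Complex.I) *
        Complex.Gamma (a - ((σ : ℂ) + (y : ℂ) * Complex.I)) / Complex.Gamma a := by
    funext y
    exact mellin_oneAdd_cpow_neg a (by simpa using hσ) (by simpa using hσ')
  rw [heq]
  exact (integrable_Gamma_vertical_cpow a hσ hσ').div_const _

/-! ### 4. The Mellin–Barnes integral -/

/-- **Mellin–Barnes integral for `(1+w)^{-a}`, complex exponent** [BrownZudilin2022, Sect. 5, "Barnes integral
representation"; Nesterenko 2003, Sect. 3.2, the `₁F₀` case of Lemma 2 of Zudilin math/0206177]: for real `w > 0`,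
`a : ℂ` and `0 < σ < Re a`,
`(1+w)^{-a} = (1/2π) ∫_ℝ w^{s} Γ(a+s)Γ(−s)/Γ(a) dy` with `s = −σ+iy` (the line `Re s = −σ` separates the poles of `Γ(−s)` from
those of `Γ(a+s)`; both `(1+w)^{−a}` and `w^{s}` are principal-branch `cpow`s of positive real bases; the integral is the
Bochner integral over `ℝ`, absolutely convergent by `integrable_Gamma_vertical_cpow'`). -/
theorem mellin_barnes_cpow (a : ℂ) {w σ : ℝ} (hw : 0 < w) (hσ : 0 < σ) (hσ' : σ < a.re) :
    (1 + (w : ℂ)) ^ (-a) =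
      (1 / (2 * π) : ℂ) * ∫ y : ℝ, (w : ℂ) ^ (-(σ : ℂ) + (y : ℂ) * Complex.I) *
        (Complex.Gamma (a + (-(σ : ℂ) + (y : ℂ) * Complex.I)) *
          Complex.Gamma (-(-(σ : ℂ) + (y : ℂ) * Complex.I)) / Complex.Gamma a) := by
  set f : ℝ → ℂ := fun t => (1 + (t : ℂ)) ^ (-a) with hf
  have hinv := mellinInv_mellin_eq σ f hw (mellinConvergent_oneAdd_cpow a (by simpa using hσ) (by simpa using hσ'))
    (verticalIntegrable_mellin_oneAdd_cpow a hσ hσ') (continuousAt_oneAdd_cpow a (by linarith))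
  rw [show (1 + (w : ℂ)) ^ (-a) = f w from rfl, ← hinv, mellinInv, Complex.real_smul]
  push_cast
  congr 1
  set B : ℝ → ℂ := fun y => (w : ℂ) ^ (-(σ : ℂ) + (y : ℂ) * Complex.I) *
        (Complex.Gamma (a + (-(σ : ℂ) + (y : ℂ) * Complex.I)) *
          Complex.Gamma (-(-(σ : ℂ) + (y : ℂ) * Complex.I)) / Complex.Gamma a) with hB
  have hA : ∀ y : ℝ, (w : ℂ) ^ (-((σ : ℂ) + (y : ℂ) * Complex.I)) • mellin f ((σ : ℂ) + (y : ℂ) * Complex.I) = B (-y) := by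
    intro y
    rw [mellin_oneAdd_cpow_neg a (by simpa using hσ) (by simpa using hσ'), smul_eq_mul, hB]
    simp only [Complex.ofReal_neg]
    rw [show -(σ : ℂ) + -(y : ℂ) * Complex.I = -((σ : ℂ) + (y : ℂ) * Complex.I) by ring,
      show a + -((σ : ℂ) + (y : ℂ) * Complex.I) = a - ((σ : ℂ) + (y : ℂ) * Complex.I) by ring, neg_neg]
    ring
  calc ∫ y : ℝ, (w : ℂ) ^ (-((σ : ℂ) + (y : ℂ) * Complex.I)) • mellin f ((σ : ℂ) + (y : ℂ) * Complex.I)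
      = ∫ y : ℝ, B (-y) := by congr 1; funext y; exact hA y
    _ = ∫ y : ℝ, B y := integral_neg_eq_self B volume

/-- The weight `Γ(a+s)Γ(−s)`, `s = −σ+iy`, is integrable in `y` (for the Fubini steps of Nesterenko's Lemmas 2–3). -/
theorem integrable_Gamma_vertical_cpow' (a : ℂ) {σ : ℝ} (hσ : 0 < σ) (hσ' : σ < a.re) :
    Integrable fun y : ℝ => Complex.Gamma (a + (-(σ : ℂ) + (y : ℂ) * Complex.I)) *
      Complex.Gamma (-(-(σ : ℂ) + (y : ℂ) * Complex.I)) := by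
  have h := (integrable_Gamma_vertical_cpow a hσ hσ').comp_neg
  refine h.congr (Eventually.of_forall fun y => ?_)
  simp only [Complex.ofReal_neg]
  rw [show a + (-(σ : ℂ) + (y : ℂ) * Complex.I) = a - ((σ : ℂ) + -(y : ℂ) * Complex.I) by ring,
    show -(-(σ : ℂ) + (y : ℂ) * Complex.I) = (σ : ℂ) + -(y : ℂ) * Complex.I by ring, mul_comm]

/-- The integer-exponent lemma of ct-1 g11 is the case `a = m+1` (consistency check). -/
theorem mellin_barnes_cpow_nat (m : ℕ) {w σ : ℝ} (hw : 0 < w) (hσ : 0 < σ) (hσ' : σ < m + 1) :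
    ((1 + (w : ℂ)) ^ (m + 1))⁻¹ =
      (1 / (2 * π) : ℂ) * ∫ y : ℝ, (w : ℂ) ^ (-(σ : ℂ) + (y : ℂ) * Complex.I) *
        (Complex.Gamma (((m : ℂ) + 1) + (-(σ : ℂ) + (y : ℂ) * Complex.I)) *
          Complex.Gamma (-(-(σ : ℂ) + (y : ℂ) * Complex.I)) / Complex.Gamma ((m : ℂ) + 1)) := by
  have h := mellin_barnes_cpow ((m : ℂ) + 1) hw hσ (by simpa using hσ')
  rw [← h, Complex.cpow_neg, show ((m : ℂ) + 1) = ((m + 1 : ℕ) : ℂ) by push_cast; ring, Complex.cpow_natCast]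

end Summit.KontsevichZagierPeriods.Zeta5Search.BarnesMellinCpow

end
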